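import Summits.BirchSwinnertonDyer.Rank1Residual.GaloisImage.KatoCharSumFourierInversion
import Mathlib.Algebra.MonoidAlgebra.Basic
import Mathlib.NumberTheory.ArithmeticFunction.Moebius
import Mathlib.Algebra.BigOperators.Fin
import HarnessLib

/-!
# The group ring `R[(ℤ/n)ˣ]` acting on `ℚ(ζ_n)`: evaluation dictionary, derivative and norm
# operators, Ramanujan's sum (cell `b2b-bsdres`, team n1011, ROUTE-1 PORT (P-KIM); OWNERS row
# T-PKEV, file E-A; seat p02 GEN 12)

HONEST FRAMING (cell `b2b-bsdres`, run/shared/lean/b2b/bsd-rank1-residual/, verbatim in every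
file): the goal of the cell is to DELETE the COMBINATION-SHAPED residual classes of the
Birch–Swinnerton-Dyer formula for ALL analytic-rank `≤ 1` elliptic curves over `ℚ` — "full BSD
formula for every rank `≤ 1` curve in class `C`" assembled STRICTLY from published theorems — so
that the rank-`≤ 1` remainder becomes exactly the CONSTRUCTION-SHAPED classes, which are TYPED
(missing-input `Prop`s), NOT attempted. This is not "finishing BSD". Team n1011 (N10/N11; ROUTE 1,
the PORT anatomy (P-KIM) of class X4 ∧ `p = 3`): research route on CONSTRUCTION-SHAPED classes;
prove what is provable now; no claim beyond stated classes; census output = EVIDENCE, never a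
Literature fact; RESIDUAL-MAP marks UNCHANGED; nothing is booked by this file. TOOL THEOREMS ONLY:
no definition, no named fact, no instance, no `sorry`.

## What

Two currencies meet on the PORT road and no landed file connects them: the GROUP RING
`MonoidAlgebra R (ZMod n)ˣ` (p13's PK-3 `MazurTateDerivative.*`: Kolyvagin's derivative
`D_i = Σ_{j<N_i} δ_{σ_i^j}·j`, the norm elements `Nrm_i = Σ_{j<N_i} δ_{σ_i^j}`, the identity
`Θ̄·∏ D_i = c·∏ Nrm_i` in `(ℤ/p^K)[(ℤ/n)ˣ]`; p15's F-B/F-C for the modular element) and the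
CYCLOTOMIC FIELD `ℚ(ζ_n)` with its operators `σ_b` (`Kato2004.EulerSystemValues.sigma`; Kato's
rational value `x ∈ ℚ(ζ_n)` of `ZetaBody` C4/C5, the field-level derivative operator
`∏_i Σ_{j<N_i} j·σ_{b_i}^j ∈ End_ℚ ℚ(ζ_n)` of p02's PK-1 `ZetaValue.zetaBody_apply_deriv_zeta_eq_tmul`,
p15's F-A Fourier inversion on character sums).  This file is the elementary dictionary between
them, stated WITHOUT new definitions in F-A's currency `Σ_{g ∈ (ℤ/n)ˣ} Y_g • σ_g z`
(the group-ring element `Y = Σ_g Y_g δ_g` ACTING on `z ∈ ℚ(ζ_n)`; at `z = ζ_n` this is the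
EVALUATION `Y ↦ Σ_g Y_g ζ_n^g`, an isomorphism onto `ℚ(ζ_n)` for square-free `n` by the normal basis
theorem — not needed and not proved here):

* §1 `sum_coeff_mul_smul_sigma` — the action is MULTIPLICATIVE:
  `Σ_g (Y·Y′)_g • σ_g z = Σ_g Y_g • σ_g (Σ_h Y′_h • σ_h z)` (through `MonoidAlgebra.lift` to
  `Module.End ℚ ℚ(ζ_n)`, `exists_monoidHom_eq_sigma` / `lift_apply_eq_sum`); `…_single_…`;
* §2 ★ `sum_coeff_mul_prod_deriv_smul_sigma` — PK-3's group-ring derivative `∏_i Σ_{j : Fin N_i}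
  single (b_i^j) j` ACTS AS PK-1's field operator
  `s.noncommProd (i ↦ Σ_{j ∈ range N_i} (j : End) * (σ_{b_i}).toLinearMap ^ j)` over any finite index
  set `s` (THEOREM A3's `r.1`, PK-3's `univ`; the `Fin`-sum of PK-3 against the `range`-sum of PK-1,
  `∏` against `noncommProd`, reconciled once); norm twin
  `sum_coeff_mul_prod_norm_smul_sigma`;
* §3 `prod_norm_eq_sum_single` — `∏_i Nrm_i = Σ_{g ∈ G} δ_g` when the `σ_i^{c_i}` (`c_i < N_i`)
  exhaust a finite commutative group `G` of order `∏ N_i` (PK-3's `hgen`; for `G = (ℤ/n)ˣ`,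
  `n` square-free, `card_units_zmod_eq_prod_sub_one`); and RAMANUJAN's sum
  `Σ_{g ∈ (ℤ/n)ˣ} ζ_n^g = μ(n)` (`sum_primitiveRoots_eq_moebius_of_isPrimitiveRoot` for any primitive
  `n`-th root in a domain, by Möbius inversion on the divisors of `n`; `sum_units_sigma_zeta_eq_moebius`)
  — so the norm element evaluates to the SCALAR `μ(n)`: `sum_coeff_sum_single_smul_sigma_zeta`;
* §4 `charSum_sum_coeff_smul_sigma` — F-A's group-ring dictionary in F-C's `MonoidAlgebra.lift`
  currency: `charSum n ι χ (Σ_g Y_g • σ_g z) = χ̄(Y) · charSum n ι χ z`.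

The `p`-adic twin (values in `ℚ_p ⊗_ℚ ℚ(ζ_n)`, the lattice `cycIntLattice` of PK-5, and the MAIN
GLUE "PK-3's conclusion in, PK-5's premise `hval` out") is file E-B
`CyclotomicGroupRingEvaluationPadic.lean`.  Consumers BY NAME: PK-6 at a general level (p13's
`skel/T-PORT-1-PKIM.md` v0.4 item (11)), PK-4b (p15 / r1 R1-71 D-55-3).  HONEST LIMITS: pure
algebra of a finite abelian group acting on a field; nothing about `ZetaBody`, Euler systems,
`exp*`, `L`-values, modular symbols or Kolyvagin systems is used or proved; closes nothing; books
nothing; 0 defs / 0 facts.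

References: K. Rubin, *Euler Systems* (2000) Def. 4.4.1 (`D_σ`, `N_σ`) [Rubin2000]; K. Kato,
Astérisque 295 (2004) (5.7.1) p. 157 (`σ_b`) [Kato2004Asterisque]; G. H. Hardy, E. M. Wright,
§16.6 Thm. 271 / M. B. Nathanson, GTM 164, Thm. A.24 (Ramanujan's sum `c_n(1) = μ(n)`)
[Nathanson1996]; orthogonality / group-ring bookkeeping [folklore].
-/

noncomputable section

open scoped BigOperators
open Finset

namespace Summit.BirchSwinnertonDyer.Rank1Residual.GaloisImage

namespace GroupRingEval

open Literature.NumberTheory.EllipticCurves.Kato2004.EulerSystemValues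

variable (n : ℕ) [NeZero n]

/-! ### §1 The group ring `ℚ[(ℤ/n)ˣ]` acts on `ℚ(ζ_n)` through the `σ_b` -/

/-- The `σ_b` assemble to a monoid homomorphism `(ℤ/n)ˣ → End_ℚ ℚ(ζ_n)` (`σ_1 = id`,
`σ_{bc} = σ_b ∘ σ_c`), in the operator spelling of PK-1 (`(sigma n b : _ →ₐ[ℚ] _).toLinearMap`).
Existence only — no definition is introduced. [cite: Kato2004Asterisque, (5.7.1) (p. 157)] -/
theorem exists_monoidHom_eq_sigma :
    ∃ Φ : (ZMod n)ˣ →* Module.End ℚ (CyclotomicField n ℚ),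
      ∀ g, Φ g = (sigma n g : CyclotomicField n ℚ →ₐ[ℚ] CyclotomicField n ℚ).toLinearMap := by
  refine ⟨{ toFun := fun g =>
              (sigma n g : CyclotomicField n ℚ →ₐ[ℚ] CyclotomicField n ℚ).toLinearMap
            map_one' := ?_
            map_mul' := ?_ }, fun g => rfl⟩
  · refine LinearMap.ext fun z => ?_
    have h1 : sigma n 1 = AlgEquiv.refl := by
      unfold sigma
      rw [map_one]
      rfl
    simp only [AlgHom.toLinearMap_apply, Module.End.one_apply, h1]
    rfl
  · intro a b
    refine LinearMap.ext fun z => ?_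
    simp only [Module.End.mul_apply, AlgHom.toLinearMap_apply]
    exact CharSum.sigma_mul_apply n a b z

/-- The algebra homomorphism `ℚ[(ℤ/n)ˣ] → End_ℚ ℚ(ζ_n)` induced by the `σ_b` sends `Y = Σ_g Y_g δ_g`
to the operator `z ↦ Σ_g Y_g • σ_g z` (F-A's currency). [folklore] -/
theorem lift_apply_eq_sum {Φ : (ZMod n)ˣ →* Module.End ℚ (CyclotomicField n ℚ)}
    (hΦ : ∀ g, Φ g = (sigma n g : CyclotomicField n ℚ →ₐ[ℚ] CyclotomicField n ℚ).toLinearMap)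
    (Y : MonoidAlgebra ℚ (ZMod n)ˣ) (z : CyclotomicField n ℚ) :
    MonoidAlgebra.lift ℚ (Module.End ℚ (CyclotomicField n ℚ)) (ZMod n)ˣ Φ Y z =
      ∑ g : (ZMod n)ˣ, Y.coeff g • sigma n g z := by
  rw [MonoidAlgebra.lift_apply, Finsupp.sum_fintype _ _ (fun g => by rw [zero_smul]),
    LinearMap.sum_apply]
  refine Finset.sum_congr rfl fun g _ => ?_
  rw [LinearMap.smul_apply, hΦ]
  rfl

/-- **The action is multiplicative**: `Σ_g (Y·Y′)_g • σ_g z = Σ_g Y_g • σ_g (Σ_h Y′_h • σ_h z)` — the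
group-ring product acts as composition of operators. [folklore] -/
theorem sum_coeff_mul_smul_sigma (Y Y' : MonoidAlgebra ℚ (ZMod n)ˣ) (z : CyclotomicField n ℚ) :
    ∑ g : (ZMod n)ˣ, (Y * Y').coeff g • sigma n g z =
      ∑ g : (ZMod n)ˣ, Y.coeff g • sigma n g (∑ h : (ZMod n)ˣ, Y'.coeff h • sigma n h z) := by
  obtain ⟨Φ, hΦ⟩ := exists_monoidHom_eq_sigma n
  rw [← lift_apply_eq_sum n hΦ, ← lift_apply_eq_sum n hΦ, ← lift_apply_eq_sum n hΦ, map_mul,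
    Module.End.mul_apply]

/-- The action is commutative in the two factors (`(ℤ/n)ˣ` is abelian). [folklore] -/
theorem sum_coeff_mul_smul_sigma_comm (Y Y' : MonoidAlgebra ℚ (ZMod n)ˣ)
    (z : CyclotomicField n ℚ) :
    ∑ g : (ZMod n)ˣ, Y.coeff g • sigma n g (∑ h : (ZMod n)ˣ, Y'.coeff h • sigma n h z) =
      ∑ g : (ZMod n)ˣ, Y'.coeff g • sigma n g (∑ h : (ZMod n)ˣ, Y.coeff h • sigma n h z) := by
  rw [← sum_coeff_mul_smul_sigma, ← sum_coeff_mul_smul_sigma, mul_comm]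

/-- A monomial `r·δ_h` acts as `r • σ_h`. [folklore] -/
theorem sum_coeff_single_smul_sigma (h : (ZMod n)ˣ) (r : ℚ) (z : CyclotomicField n ℚ) :
    ∑ g : (ZMod n)ˣ, (MonoidAlgebra.single h r).coeff g • sigma n g z = r • sigma n h z := by
  obtain ⟨Φ, hΦ⟩ := exists_monoidHom_eq_sigma n
  rw [← lift_apply_eq_sum n hΦ, MonoidAlgebra.lift_single, LinearMap.smul_apply, hΦ]
  rfl

/-- The sum of all `δ_g` acts as the trace-type operator `z ↦ Σ_g σ_g z`. [folklore] -/
theorem sum_coeff_sum_single_smul_sigma (z : CyclotomicField n ℚ) :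
    ∑ g : (ZMod n)ˣ, (∑ h : (ZMod n)ˣ, MonoidAlgebra.single h (1 : ℚ)).coeff g • sigma n g z =
      ∑ g : (ZMod n)ˣ, sigma n g z := by
  refine Finset.sum_congr rfl fun g _ => ?_
  rw [MonoidAlgebra.coeff_sum, Finset.sum_apply',
    Finset.sum_eq_single g (fun h _ hne => by
      rw [MonoidAlgebra.single, MonoidAlgebra.coeff_ofCoeff, Finsupp.single_eq_of_ne hne.symm])
      (fun hg => absurd (Finset.mem_univ g) hg)]
  rw [MonoidAlgebra.single, MonoidAlgebra.coeff_ofCoeff, Finsupp.single_eq_same, one_smul]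

/-! ### §2 Kolyvagin's derivative and norm elements act as PK-1's field operators -/

/-- **★ The group-ring derivative acts as the field-level derivative operator.**  For units
`b_i ∈ (ℤ/n)ˣ` and lengths `N_i` (`i ∈ ι` finite), PK-3's element
`∏_{i∈s} Σ_{j : Fin N_i} δ_{b_i^j}·j ∈ ℚ[(ℤ/n)ˣ]` multiplied onto `Y` acts on `z ∈ ℚ(ζ_n)` as PK-1's /
THEOREM A3's operator `∏_{i∈s} Σ_{j < N_i} j·σ_{b_i}^j ∈ End_ℚ ℚ(ζ_n)` (a `noncommProd` over the finite index
set `s` of pairwise commuting operators) applied to the action of `Y`: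
`Σ_g (Y·∏_i D_i)_g • σ_g z = (∏_i Σ_{j<N_i} j σ_{b_i}^j)(Σ_g Y_g • σ_g z)`.
[cite: Rubin2000, Def. 4.4.1] -/
theorem sum_coeff_mul_prod_deriv_smul_sigma {ι : Type*} (s : Finset ι)
    (b : ι → (ZMod n)ˣ) (N : ι → ℕ) (Y : MonoidAlgebra ℚ (ZMod n)ˣ) (z : CyclotomicField n ℚ)
    (comm : (s : Set ι).Pairwise fun i i' => Commute
      (∑ j ∈ Finset.range (N i), (j : Module.End ℚ (CyclotomicField n ℚ)) *
        (sigma n (b i) : CyclotomicField n ℚ →ₐ[ℚ] CyclotomicField n ℚ).toLinearMap ^ j)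
      (∑ j ∈ Finset.range (N i'), (j : Module.End ℚ (CyclotomicField n ℚ)) *
        (sigma n (b i') : CyclotomicField n ℚ →ₐ[ℚ] CyclotomicField n ℚ).toLinearMap ^ j)) :
    ∑ g : (ZMod n)ˣ, (Y * ∏ i ∈ s, ∑ j : Fin (N i),
        MonoidAlgebra.single (b i ^ (j : ℕ)) ((j : ℕ) : ℚ)).coeff g • sigma n g z =
      (s.noncommProd (fun i => ∑ j ∈ Finset.range (N i),
        (j : Module.End ℚ (CyclotomicField n ℚ)) *
          (sigma n (b i) : CyclotomicField n ℚ →ₐ[ℚ] CyclotomicField n ℚ).toLinearMap ^ j) comm)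
        (∑ g : (ZMod n)ˣ, Y.coeff g • sigma n g z) := by
  obtain ⟨Φ, hΦ⟩ := exists_monoidHom_eq_sigma n
  rw [← lift_apply_eq_sum n hΦ, ← lift_apply_eq_sum n hΦ, mul_comm, map_mul, Module.End.mul_apply]
  congr 1
  rw [← Finset.noncommProd_eq_prod, Finset.map_noncommProd]
  refine Finset.noncommProd_congr rfl (fun i _ => ?_) _
  rw [map_sum, Finset.sum_range (fun j => (j : Module.End ℚ (CyclotomicField n ℚ)) *
    (sigma n (b i) : CyclotomicField n ℚ →ₐ[ℚ] CyclotomicField n ℚ).toLinearMap ^ j)]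
  refine Finset.sum_congr rfl fun j _ => ?_
  rw [MonoidAlgebra.lift_single, map_pow, hΦ, Nat.cast_smul_eq_nsmul, nsmul_eq_mul]

/-- **Norm twin**: `∏_{i∈s} Σ_{j : Fin N_i} δ_{b_i^j}` multiplied onto `Y` acts as
`∏_{i∈s} Σ_{j<N_i} σ_{b_i}^j` applied to the action of `Y`. [cite: Rubin2000, Def. 4.4.1] -/
theorem sum_coeff_mul_prod_norm_smul_sigma {ι : Type*} (s : Finset ι)
    (b : ι → (ZMod n)ˣ) (N : ι → ℕ) (Y : MonoidAlgebra ℚ (ZMod n)ˣ) (z : CyclotomicField n ℚ)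
    (comm : (s : Set ι).Pairwise fun i i' => Commute
      (∑ j ∈ Finset.range (N i),
        (sigma n (b i) : CyclotomicField n ℚ →ₐ[ℚ] CyclotomicField n ℚ).toLinearMap ^ j)
      (∑ j ∈ Finset.range (N i'),
        (sigma n (b i') : CyclotomicField n ℚ →ₐ[ℚ] CyclotomicField n ℚ).toLinearMap ^ j)) :
    ∑ g : (ZMod n)ˣ, (Y * ∏ i ∈ s, ∑ j : Fin (N i),
        MonoidAlgebra.single (b i ^ (j : ℕ)) (1 : ℚ)).coeff g • sigma n g z =
      (s.noncommProd (fun i => ∑ j ∈ Finset.range (N i),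
          (sigma n (b i) : CyclotomicField n ℚ →ₐ[ℚ] CyclotomicField n ℚ).toLinearMap ^ j) comm)
        (∑ g : (ZMod n)ˣ, Y.coeff g • sigma n g z) := by
  obtain ⟨Φ, hΦ⟩ := exists_monoidHom_eq_sigma n
  rw [← lift_apply_eq_sum n hΦ, ← lift_apply_eq_sum n hΦ, mul_comm, map_mul, Module.End.mul_apply]
  congr 1
  rw [← Finset.noncommProd_eq_prod, Finset.map_noncommProd]
  refine Finset.noncommProd_congr rfl (fun i _ => ?_) _
  rw [map_sum, Finset.sum_range (fun j =>
    (sigma n (b i) : CyclotomicField n ℚ →ₐ[ℚ] CyclotomicField n ℚ).toLinearMap ^ j)]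
  refine Finset.sum_congr rfl fun j _ => ?_
  rw [MonoidAlgebra.lift_single, map_pow, hΦ, one_smul]

/-! ### §3 The norm element and Ramanujan's sum -/

section NormElement

variable {R : Type*} [CommSemiring R] {G : Type*} [CommGroup G] [Fintype G]
  {ι : Type*} [Fintype ι] [DecidableEq ι]

omit [NeZero n] in
/-- **The product of the norm elements is the full norm element** `∏_i Nrm_i = Σ_{g ∈ G} δ_g`, when
the products `∏_i σ_i^{c_i}` (`c_i < N_i`) exhaust a finite commutative group `G` (PK-3's `hgen`)
of order `∏_i N_i` (then they exhaust it bijectively). [cite: Rubin2000, Def. 4.4.1] -/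
theorem prod_norm_eq_sum_single (σ : ι → G) (N : ι → ℕ)
    (hgen : ∀ a : G, ∃ c : ∀ i, Fin (N i), a = ∏ i, σ i ^ (c i : ℕ))
    (hcard : Fintype.card G = ∏ i, N i) :
    ∏ i, ∑ j : Fin (N i), MonoidAlgebra.single (σ i ^ (j : ℕ)) (1 : R) =
      ∑ g : G, MonoidAlgebra.single g 1 := by
  classical
  -- expand the product over the box of exponents `∀ i, Fin (N i)`
  have hbox : ∏ i, ∑ j : Fin (N i), MonoidAlgebra.single (σ i ^ (j : ℕ)) (1 : R) =
      ∑ J : ∀ i, Fin (N i), MonoidAlgebra.single (∏ i, σ i ^ (J i : ℕ)) (1 : R) := by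
    have h := Finset.prod_univ_sum (fun i => (Finset.univ : Finset (Fin (N i))))
      (fun i j => MonoidAlgebra.single (σ i ^ (j : ℕ)) (1 : R))
    rw [Fintype.piFinset_univ] at h
    rw [h]
    refine Finset.sum_congr rfl fun J _ => ?_
    rw [MonoidAlgebra.prod_single, Finset.prod_const_one]
  rw [hbox]
  -- the box maps onto `G` (hgen) and has the same cardinality: a bijection
  have hsurj : Function.Surjective (fun J : ∀ i, Fin (N i) => ∏ i, σ i ^ (J i : ℕ)) :=
    fun a => by obtain ⟨c, hc⟩ := hgen a; exact ⟨c, hc.symm⟩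
  have hbij : Function.Bijective (fun J : ∀ i, Fin (N i) => ∏ i, σ i ^ (J i : ℕ)) := by
    rw [Fintype.bijective_iff_surjective_and_card]
    exact ⟨hsurj, by rw [hcard, Fintype.card_pi]; simp⟩
  exact Fintype.sum_bijective _ hbij _ _ fun J => rfl

end NormElement

/-- `#(ℤ/n)ˣ = ∏_{ℓ ∣ n} (ℓ − 1)` for square-free `n` (Euler's `φ` on a square-free number), in the
indexing of PK-3 (`ℓ : n.primeFactors`). [folklore] -/
theorem card_units_zmod_eq_prod_sub_one (hn : Squarefree n) :
    Fintype.card (ZMod n)ˣ = ∏ ℓ : n.primeFactors, ((ℓ : ℕ) - 1) := by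
  rw [ZMod.card_units_eq_totient, Nat.totient_eq_div_primeFactors_mul,
    Nat.prod_primeFactors_of_squarefree hn, Nat.div_self (Nat.pos_of_ne_zero (NeZero.ne n)), one_mul,
    ← Finset.prod_coe_sort n.primeFactors (fun ℓ : ℕ => ℓ - 1)]

section Ramanujan

open ArithmeticFunction Polynomial

variable {F : Type*} [CommRing F] [IsDomain F]

omit [NeZero n] in
/-- The sum of ALL `m`-th roots of unity is `[m = 1]`, for `m` dividing the order `n` of a
primitive root of unity `ζ ∈ F` (then `F` holds all `m`-th roots: the powers of `ζ^{n/m}`).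
[folklore] -/
theorem sum_nthRootsFinset_eq_of_dvd {ζ : F} (hζ : IsPrimitiveRoot ζ n) (hn : 0 < n) {m : ℕ}
    (hm : m ∣ n) : ∑ x ∈ nthRootsFinset m (1 : F), x = if m = 1 then 1 else 0 := by
  classical
  obtain ⟨d, rfl⟩ := hm
  have hm0 : 0 < m := Nat.pos_of_ne_zero (by rintro rfl; simp at hn)
  have hd0 : 0 < d := Nat.pos_of_ne_zero (by rintro rfl; simp at hn)
  haveI : NeZero m := ⟨hm0.ne'⟩
  have hη : IsPrimitiveRoot (ζ ^ d) m := by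
    have := hζ.pow_of_dvd hd0.ne' (Dvd.intro_left m rfl)
    rwa [Nat.mul_div_cancel _ hd0] at this
  have h1 : nthRootsFinset m (1 : F) = (Finset.range m).image (fun i => (ζ ^ d) ^ i) := by
    ext x
    rw [Polynomial.mem_nthRootsFinset hm0 (1 : F), Finset.mem_image]
    constructor
    · intro hx
      obtain ⟨i, hi, rfl⟩ := hη.eq_pow_of_pow_eq_one hx
      exact ⟨i, Finset.mem_range.2 hi, rfl⟩
    · rintro ⟨i, -, rfl⟩
      rw [← pow_mul, mul_comm, pow_mul, hη.pow_eq_one, one_pow]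
  rw [h1, Finset.sum_image]
  · split_ifs with h
    · subst h; simp
    · exact hη.geom_sum_eq_zero (by omega)
  · intro i hi j hj h
    exact hη.pow_inj (Finset.mem_range.1 hi) (Finset.mem_range.1 hj) h

omit [NeZero n] in
/-- **Ramanujan's sum `c_n(1) = μ(n)`** in any domain holding a primitive `n`-th root of unity: the
sum of the primitive `n`-th roots of unity is `μ(n)`.  (The `m`-th roots of unity, `m ∣ n`, are the
disjoint union of the primitive `d`-th roots over `d ∣ m`, so `Σ_{d ∣ m} c_d(1) = [m = 1]` on the
divisor-closed set `{m : m ∣ n}`; Möbius inversion on that set,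
`ArithmeticFunction.sum_eq_iff_sum_smul_moebius_eq_on`.)  The tree's `ℂ`-valued instance
(`Literature.NumberTheory.Sieve`, circle method) is not imported into the PORT files.
[cite: Nathanson1996, Thm A.24] -/
theorem sum_primitiveRoots_eq_moebius_of_isPrimitiveRoot {ζ : F} (hζ : IsPrimitiveRoot ζ n)
    (hn : 0 < n) : ∑ x ∈ primitiveRoots n F, x = ((ArithmeticFunction.moebius n : ℤ) : F) := by
  classical
  have key : ∀ m > 0, m ∈ {m : ℕ | m ∣ n} →
      ∑ d ∈ m.divisors, (∑ x ∈ primitiveRoots d F, x) = if m = 1 then (1 : F) else 0 := by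
    intro m hm hmn
    rw [← sum_nthRootsFinset_eq_of_dvd n hζ hn hmn,
      IsPrimitiveRoot.nthRoots_one_eq_biUnion_primitiveRoots, Finset.sum_biUnion]
    intro d _ e _ hde
    exact IsPrimitiveRoot.disjoint hde
  have hinv := (ArithmeticFunction.sum_eq_iff_sum_smul_moebius_eq_on {m : ℕ | m ∣ n}
    (fun a b hab hb => dvd_trans hab hb)).1 key n hn (dvd_refl n)
  rw [← hinv, Finset.sum_eq_single (n, 1)]
  · simp
  · rintro ⟨d, e⟩ hde hne
    have he : e ≠ 1 := by
      rintro rfl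
      simp only [Nat.mem_divisorsAntidiagonal, mul_one] at hde
      exact hne (by rw [hde.1])
    simp [he]
  · intro h
    exact absurd (Nat.mem_divisorsAntidiagonal.2 ⟨mul_one n, hn.ne'⟩) h

omit [NeZero n] in
/-- **Ramanujan's sum over the unit group**: `Σ_{g ∈ (ℤ/n)ˣ} ζ^g = μ(n)` for a primitive `n`-th root
`ζ` of a domain (`g ↦ ζ^g` is a bijection from `(ℤ/n)ˣ` onto the primitive `n`-th roots).
[cite: Nathanson1996, Thm A.24] -/
theorem sum_units_pow_val_eq_moebius [NeZero n] {ζ : F} (hζ : IsPrimitiveRoot ζ n) :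
    ∑ g : (ZMod n)ˣ, ζ ^ (g : ZMod n).val = ((ArithmeticFunction.moebius n : ℤ) : F) := by
  classical
  have hn : 0 < n := Nat.pos_of_ne_zero (NeZero.ne n)
  rw [← sum_primitiveRoots_eq_moebius_of_isPrimitiveRoot n hζ hn]
  refine Finset.sum_bij (fun g _ => ζ ^ (g : ZMod n).val) ?_ ?_ ?_ (fun _ _ => rfl)
  · intro g _
    exact (mem_primitiveRoots hn).2 (hζ.pow_of_coprime _ (ZMod.val_coe_unit_coprime g))
  · intro g _ g' _ h
    exact Units.ext (ZMod.val_injective n (hζ.pow_inj (ZMod.val_lt _) (ZMod.val_lt _) h))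
  · intro x hx
    rw [mem_primitiveRoots hn] at hx
    obtain ⟨i, hi, rfl⟩ := hζ.eq_pow_of_pow_eq_one hx.pow_eq_one
    have hcop : i.Coprime n := (hζ.pow_iff_coprime hn i).1 hx
    refine ⟨ZMod.unitOfCoprime i hcop, Finset.mem_univ _, ?_⟩
    rw [ZMod.coe_unitOfCoprime, ZMod.val_natCast, Nat.mod_eq_of_lt hi]

end Ramanujan

set_option backward.isDefEq.respectTransparency false in
/-- **The norm element evaluates to the scalar `μ(n)`**: `Σ_{g ∈ (ℤ/n)ˣ} σ_g ζ_n = μ(n)` in `ℚ(ζ_n)`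
(`σ_g ζ_n = ζ_n^g`, Kato (5.7.1), and Ramanujan's sum). [cite: Nathanson1996, Thm A.24] -/
theorem sum_units_sigma_zeta_eq_moebius :
    ∑ g : (ZMod n)ˣ, sigma n g (IsCyclotomicExtension.zeta n ℚ (CyclotomicField n ℚ)) =
      ((ArithmeticFunction.moebius n : ℤ) : CyclotomicField n ℚ) := by
  simp_rw [sigma_apply_zeta]
  exact sum_units_pow_val_eq_moebius n (IsCyclotomicExtension.zeta_spec n ℚ (CyclotomicField n ℚ))

set_option backward.isDefEq.respectTransparency false in
/-- **The full norm element `Σ_g δ_g` acts on `ζ_n` as the scalar `μ(n)`.**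
[cite: Nathanson1996, Thm A.24] -/
theorem sum_coeff_sum_single_smul_sigma_zeta :
    ∑ g : (ZMod n)ˣ, (∑ h : (ZMod n)ˣ, MonoidAlgebra.single h (1 : ℚ)).coeff g •
        sigma n g (IsCyclotomicExtension.zeta n ℚ (CyclotomicField n ℚ)) =
      ((ArithmeticFunction.moebius n : ℤ) : CyclotomicField n ℚ) := by
  rw [sum_coeff_sum_single_smul_sigma, sum_units_sigma_zeta_eq_moebius]

/-! ### §4 Character sums of the action: F-A's dictionary in the `MonoidAlgebra.lift` currency -/

/-- **`charSum n ι χ (Σ_g Y_g • σ_g z) = χ̄(Y) · charSum n ι χ z`**, `χ̄(Y) = Σ_g Y_g χ⁻¹(g)` the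
`χ⁻¹`-component of `Y` in F-C's `MonoidAlgebra.lift` spelling — F-A's `charSum_sum_smul_sigma`.
[cite: Kato2004Asterisque, Thm. 6.6 (1) (p. 163)] -/
theorem charSum_sum_coeff_smul_sigma (ι : CyclotomicField n ℚ →+* ℂ) (χ : DirichletCharacter ℂ n)
    (Y : MonoidAlgebra ℚ (ZMod n)ˣ) (z : CyclotomicField n ℚ) :
    charSum n ι χ (∑ g : (ZMod n)ˣ, Y.coeff g • sigma n g z) =
      MonoidAlgebra.lift ℚ ℂ (ZMod n)ˣ ((Units.coeHom ℂ).comp χ⁻¹.toUnitHom) Y *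
        charSum n ι χ z := by
  rw [CharSum.charSum_sum_smul_sigma n ι χ (fun g => Y.coeff g) z, MonoidAlgebra.lift_apply,
    Finsupp.sum_fintype _ _ (fun g => by rw [zero_smul])]
  congr 1
  refine Finset.sum_congr rfl fun g _ => ?_
  rw [Algebra.smul_def, eq_ratCast, MonoidHom.comp_apply, Units.coeHom_apply,
    MulChar.coe_toUnitHom, mul_comm]

end GroupRingEval

end Summit.BirchSwinnertonDyer.Rank1Residual.GaloisImage

end
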